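import Literature.Topology.FourManifolds.LatticeFormsSpecialOrthogonalSignatureZeroPerfect
import HarnessLib

/-!
# `SO⁺(U^{⊕n}) = ⟨σ_aσ_b : a² = b² = −2⟩ = ⟨σ_aσ_b : a² = b² = +2⟩` (Kneser's form) and Markman's
# `SO₊(U^{⊕k}) = SRef₊(U^{⊕k})`, `SO(U^{⊕k}) = SRef(U^{⊕k})` for all `k ≥ 3`
# (Gritsenko–Hulek–Sankaran, *J. Algebra* 322 (2009) Thm. 1.1, Cor. 1.2, (16); Markman, *JEMS* (2023) §7, Cor. 7.1)

Trunk T-4MAN vocabulary. Kneser's theorem (GHS Thm. 1.1) says that the spinorial kernel `O′(L)` is generated by the products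
`σ_aσ_b` of PAIRS of `(−2)`-reflections, and Cor. 1.2 / (16) identify `O′(L) = S̃O⁺(L)`; Markman's Cor. 7.1 states
`SO₊(U^{⊕k}) = SRef₊(U^{⊕k})` for `k ≥ 3`, `SRef₊` being generated by products of an even number of like-sign `(±2)`-reflections.
Rows g49-#8/#15 proved the SINGLE-reflection statements (`O⁺(U^{⊕n}) = ⟨σ_r : r² = −2⟩`, Wall's `O(U^{⊕n}) = ⟨σ_r : r² = ±2⟩`)
and row g50-#1 `SO⁺(U^{⊕n}) = E_{U_i}`. This file passes to pairs: a word in reflections of determinant `1` has even length once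
inverse letters are removed (`σ_r⁻¹ = σ_r`), hence is a word in products of two reflections (§1, any lattice); so `SO⁺(U^{⊕n})`
is exactly the group generated by the `σ_aσ_b` with `a² = b² = −2`, or with `a² = b² = +2`, or (Markman) by both kinds, and
`SO(U^{⊕n})` is generated by all products of two `(±2)`-reflections (§2); model-free and `II_{n,n}` versions in §3. Written for
lane `lit-hodgefound` (Track 2 foundations; prover seat `lit-hodgefound-p18`, gen 50, row g50-#4). THEOREMS ONLY — no definition,
no named fact, no instance, no notation.

## Sources, verbatim

* GHS 2009 (held `paper:arxiv-0810.1614`) p. 3: "**Theorem 1.1** ([Kn1]) Let `L` be an even integral lattice of Witt index `≥ 2`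
  over `ℝ`. We assume that `L` represents `−2` and that `rank₃(L) ≥ 5` and `rank₂(L) ≥ 6`. Then `O′(L)` is generated by the
  products of reflections `σ_aσ_b` where `a, b ∈ L` and `a² = b² = −2`." "**Corollary 1.2** If `L` satisfies the Kneser
  conditions, then `O′(L) = S̃O⁺(L)`." "Note that Corollary 1.2 is also true with opposite signs, i.e. if `L` contains at least
  one `2`-vector and we consider the reflections `σ_a` with `a² = 2`." p. 7 (16): "`S̃O⁺(L) = O′(L) = E(L) = E_U(L₁)`".
* Markman 2023 (held `paper:arxiv-1805.11574`) §7, p. 25: "Set `SRef(Λ) := Ref(Λ) ∩ SO(Λ)` and `SRef₊(Λ) := Ref(Λ) ∩ SO₊(Λ)`.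
  The former is generated by elements, which are products of an even number of reflections. `SRef₊(Λ)` is generated by
  elements, which are either products of an even number of reflections in `+2` vectors, or products of an even number of
  reflections in `−2` vectors. […] The orthogonal group is generated by reflections, `O(U^{⊕k}) = Ref(U^{⊕k})`, for `k ≥ 3` (see
  [wall]). Consequently, we get the following. **Corollary 7.1.** `SO₊(U^{⊕k}) = SRef₊(U^{⊕k})`, for `k ≥ 3`."

For `L = U^{⊕n}` (`n ≥ 3`; even unimodular, `rank_p = 2n ≥ 6`, Witt index `n`, represents `∓2`): `O′(L) = S̃O⁺(L) = SO⁺(L)`.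

## Contents (all proved)

* §1 (any integral lattice) `σ_r⁻¹ = σ_r` (`normTwoReflectionEquiv_symm`); a word in a symmetric set `S` of isometries of
  determinant `−1` whose product has determinant `1` is a word in the pairs `{s·t : s, t ∈ S}` (`IsWordIn.pairs_of_det_eq_one`:
  normalise inverse letters, parity of the length from `det = (−1)^{length}`, pair up neighbours).
* §2 `U^{⊕n}`, `n ≥ 3`: `SO⁺ ⊆ ⟨σ_r : r² = 2ε⟩` for either sign (`hyperbolicSum_isWordIn_reflections_of_isOrientationPreserving_of_det_eq_one`);
  **`SO⁺(U^{⊕n}) = ⟨σ_aσ_b : a² = b² = −2⟩`** (`hyperbolicSum_isWordIn_negTwoReflectionPairs_iff`, Kneser's form);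
  **`= ⟨σ_aσ_b : a² = b² = +2⟩`** (`hyperbolicSum_isWordIn_posTwoReflectionPairs_iff`, "opposite signs"); **Markman's Cor. 7.1**
  (`hyperbolicSum_isWordIn_likeSignReflectionPairs_iff`); **`SO(U^{⊕n}) = SRef(U^{⊕n})`**: words in products of two
  `(±2)`-reflections are exactly the isometries of determinant `1` (`hyperbolicSum_isWordIn_reflectionPairs_iff_det_eq_one`).
* §3 Kneser's form model-free for every `L ≅ U^{⊕n}` and hypothesis-style for the genus `II_{n,n}`, `n ≥ 3`.
-/

noncomputable section

open Module
open LinearMap (BilinForm)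
open LinearMap.BilinForm
open LinearMap.BilinForm (IsometryEquiv)

namespace Literature.Topology.FourManifolds

universe u

/-! ### §1 Words of determinant `1` in involutions of determinant `−1` are words in pairs -/

section Pairs

variable {W : Type*} [AddCommGroup W] {B : BilinForm ℤ W}

/-- **`σ_r⁻¹ = σ_r`**: the reflection in a `(±2)`-vector is an involution. [cite: GritsenkoHulekSankaran2009, §3.1 ("σ_a and σ_{e−f} commute"; reflections)] [cite: MilnorHusemoller1973, §I.3] -/
theorem normTwoReflectionEquiv_symm (hB : B.IsSymm) (r : W) (ε : ℤ) (hr : B r r = ε + ε) (hε : ε * ε = 1) :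
    (normTwoReflectionEquiv hB r ε hr hε).symm = normTwoReflectionEquiv hB r ε hr hε := by
  refine DFunLike.ext _ _ fun v ↦ ?_
  have hinv : ∀ w, normTwoReflectionEquiv hB r ε hr hε (normTwoReflectionEquiv hB r ε hr hε w) = w := fun w ↦ by
    rw [normTwoReflectionEquiv_apply, normTwoReflectionEquiv_apply, map_sub, map_smul, smul_eq_mul, hr,
      show ε * (B r w - ε * B r w * (ε + ε)) = -(ε * B r w) by linear_combination (-2 * ε * B r w) * hε, neg_smul,
      sub_neg_eq_add, sub_add_cancel]
  rw [← hinv ((normTwoReflectionEquiv hB r ε hr hε).symm v), LinearMap.BilinForm.IsometryEquiv.apply_symm_apply]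

/-- A word in a set `S` closed under inverses is the product of a list of members of `S` (inverse letters replaced).
[cite: GritsenkoHulekSankaran2009, §3 ("the group generated by")] -/
theorem IsWordIn.exists_list_of_symm_mem {S : Set (B.IsometryEquiv B)} (hS : ∀ s ∈ S, s.symm ∈ S) {φ : B.IsometryEquiv B}
    (hφ : IsWordIn S φ) : ∃ l : List (B.IsometryEquiv B), (∀ s ∈ l, s ∈ S) ∧ ∀ v, wordProd l v = φ v := by
  obtain ⟨l, hl, hlφ⟩ := hφ
  refine ⟨l, fun s hs ↦ ?_, hlφ⟩
  rcases hl s hs with h | h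
  · exact h
  · rw [← LinearMap.BilinForm.IsometryEquiv.symm_symm s]
    exact hS _ h

/-- A product of an EVEN number of members of `S` is a word in the pairs `s·t`, `s, t ∈ S`.
[cite: Markman2023GeneralizedKummers, §7 ("generated by elements, which are products of an even number of reflections")] -/
theorem isWordIn_pairs_wordProd_of_even {S : Set (B.IsometryEquiv B)} (l : List (B.IsometryEquiv B)) (hl : ∀ s ∈ l, s ∈ S)
    (heven : Even l.length) : IsWordIn {χ : B.IsometryEquiv B | ∃ s ∈ S, ∃ t ∈ S, χ = s.trans t} (wordProd l) := by
  obtain ⟨k, hk⟩ := heven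
  induction k generalizing l with
  | zero =>
    obtain rfl : l = [] := List.eq_nil_of_length_eq_zero (by omega)
    exact IsWordIn.refl
  | succ k ih =>
    rcases l with _ | ⟨a, _ | ⟨b, rest⟩⟩
    · simp at hk
    · simp at hk
      omega
    · have hrest : rest.length = k + k := by
        simp only [List.length_cons] at hk
        omega
      have hab : IsWordIn {χ : B.IsometryEquiv B | ∃ s ∈ S, ∃ t ∈ S, χ = s.trans t} (a.trans b) :=
        IsWordIn.of_mem ⟨a, hl a (by simp), b, hl b (by simp), rfl⟩
      exact (hab.trans (ih rest (fun s hs ↦ hl s (List.mem_cons_of_mem _ (List.mem_cons_of_mem _ hs))) hrest)).congr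
        fun v ↦ rfl

/-- `det` of a product of letters of determinant `−1` is `(−1)^{length}`. [cite: GritsenkoHulekSankaran2009, Cor. 1.8 ("det" is a character)] -/
theorem det_wordProd_eq_neg_one_pow (l : List (B.IsometryEquiv B))
    (hl : ∀ s ∈ l, LinearMap.det ((s : B.IsometryEquiv B) : W →ₗ[ℤ] W) = -1) :
    LinearMap.det ((wordProd l : B.IsometryEquiv B) : W →ₗ[ℤ] W) = (-1) ^ l.length := by
  induction l with
  | nil =>
    rw [wordProd_nil, List.length_nil, pow_zero,
      show ((LinearMap.BilinForm.IsometryEquiv.refl B : B.IsometryEquiv B) : W →ₗ[ℤ] W) = LinearMap.id from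
        LinearMap.ext fun _ ↦ rfl, LinearMap.det_id]
  | cons s l ih =>
    rw [wordProd_cons, List.length_cons, pow_succ, IsometryEquiv.det_trans_eq_mul,
      ih fun t ht ↦ hl t (List.mem_cons_of_mem _ ht), hl s List.mem_cons_self]

/-- **The determinant-`1` part of a group generated by involutions of determinant `−1` is generated by the pairs**: for a set
`S` of isometries closed under inverses with `det = −1` on `S`, every word in `S` of determinant `1` is a word in
`{s·t : s, t ∈ S}` ("`SRef(Λ) := Ref(Λ) ∩ SO(Λ)` […] is generated by elements, which are products of an even number of
reflections"). [cite: Markman2023GeneralizedKummers, §7 (before Cor. 7.1)] -/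
theorem IsWordIn.pairs_of_det_eq_one {S : Set (B.IsometryEquiv B)} (hS : ∀ s ∈ S, s.symm ∈ S)
    (hSdet : ∀ s ∈ S, LinearMap.det ((s : B.IsometryEquiv B) : W →ₗ[ℤ] W) = -1) {φ : B.IsometryEquiv B}
    (hφ : IsWordIn S φ) (hdet : LinearMap.det (φ : W →ₗ[ℤ] W) = 1) :
    IsWordIn {χ : B.IsometryEquiv B | ∃ s ∈ S, ∃ t ∈ S, χ = s.trans t} φ := by
  obtain ⟨l, hl, hlφ⟩ := hφ.exists_list_of_symm_mem hS
  have hφl : wordProd l = φ := DFunLike.ext _ _ hlφ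
  have heven : Even l.length := by
    rcases Nat.even_or_odd l.length with h | h
    · exact h
    · have hd := det_wordProd_eq_neg_one_pow l fun s hs ↦ hSdet s (hl s hs)
      rw [hφl, hdet, h.neg_one_pow] at hd
      norm_num at hd
  exact (isWordIn_pairs_wordProd_of_even l hl heven).congr hlφ

variable [Module.Finite ℤ W] [Module.Free ℤ W]

/-- The `(2ε)`-reflections form a set closed under inverses, each of determinant `−1` (inputs of `IsWordIn.pairs_of_det_eq_one`).
[cite: GritsenkoHulekSankaran2009, §1 (reflections σ_a)] [cite: MilnorHusemoller1973, §I.3] -/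
theorem reflections_symm_mem_and_det (hB : B.IsSymm) {ε : ℤ} (hε : ε * ε = 1) :
    (∀ s ∈ {ψ : B.IsometryEquiv B | ∃ (r : W) (hr : B r r = ε + ε), ψ = normTwoReflectionEquiv hB r ε hr hε},
      s.symm ∈ {ψ : B.IsometryEquiv B | ∃ (r : W) (hr : B r r = ε + ε), ψ = normTwoReflectionEquiv hB r ε hr hε}) ∧
    ∀ s ∈ {ψ : B.IsometryEquiv B | ∃ (r : W) (hr : B r r = ε + ε), ψ = normTwoReflectionEquiv hB r ε hr hε},
      LinearMap.det ((s : B.IsometryEquiv B) : W →ₗ[ℤ] W) = -1 := by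
  refine ⟨fun s hs ↦ ?_, fun s hs ↦ ?_⟩
  · obtain ⟨r, hr, rfl⟩ := hs
    exact ⟨r, hr, normTwoReflectionEquiv_symm hB r ε hr hε⟩
  · obtain ⟨r, hr, rfl⟩ := hs
    exact det_normTwoReflectionEquiv _ hB r ε hr hε

/-- The same for the set of ALL `(±2)`-reflections (both signs). [cite: Markman2023GeneralizedKummers, §7 ("reflections in +2 and −2 vectors in Λ")] -/
theorem reflections_symm_mem_and_det' (hB : B.IsSymm) :
    (∀ s ∈ {ψ : B.IsometryEquiv B | ∃ (r : W) (ε : ℤ) (hε : ε * ε = 1) (hr : B r r = ε + ε), ψ = normTwoReflectionEquiv hB r ε hr hε},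
      s.symm ∈ {ψ : B.IsometryEquiv B | ∃ (r : W) (ε : ℤ) (hε : ε * ε = 1) (hr : B r r = ε + ε),
        ψ = normTwoReflectionEquiv hB r ε hr hε}) ∧
    ∀ s ∈ {ψ : B.IsometryEquiv B | ∃ (r : W) (ε : ℤ) (hε : ε * ε = 1) (hr : B r r = ε + ε), ψ = normTwoReflectionEquiv hB r ε hr hε},
      LinearMap.det ((s : B.IsometryEquiv B) : W →ₗ[ℤ] W) = -1 := by
  refine ⟨fun s hs ↦ ?_, fun s hs ↦ ?_⟩
  · obtain ⟨r, ε, hε, hr, rfl⟩ := hs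
    exact ⟨r, ε, hε, hr, normTwoReflectionEquiv_symm hB r ε hr hε⟩
  · obtain ⟨r, ε, hε, hr, rfl⟩ := hs
    exact det_normTwoReflectionEquiv _ hB r ε hr hε

end Pairs

/-! ### §2 `U^{⊕n}`, `n ≥ 3` -/

section HyperbolicSum

/-- **`SO⁺(U^{⊕n}) ⊆ ⟨σ_r : r² = 2ε⟩` for either sign `ε = ±1`, `n ≥ 3`** (the inclusion `E(L) ⊆ ⟨σ_aσ_b⟩` of (16), via
`SO⁺ = E_{U₀}` and a `(2ε)`-vector `e₂ + εf₂ ⊥ U₀ ⊕ U₁`). [cite: GritsenkoHulekSankaran2009, §3.3 (16) and §3.1 (t6)] -/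
theorem hyperbolicSum_isWordIn_reflections_of_isOrientationPreserving_of_det_eq_one {n : ℕ} (hn : 3 ≤ n) {ε : ℤ}
    (hε : ε * ε = 1) (φ : (hyperbolicSum n).IsometryEquiv (hyperbolicSum n)) (h₁ : φ.IsOrientationPreserving)
    (h₂ : LinearMap.det (φ : (Fin n → ℤ) × (Fin n → ℤ) →ₗ[ℤ] (Fin n → ℤ) × (Fin n → ℤ)) = 1) :
    IsWordIn {ψ : (hyperbolicSum n).IsometryEquiv (hyperbolicSum n) | ∃ (r : (Fin n → ℤ) × (Fin n → ℤ))
      (hr : hyperbolicSum n r r = ε + ε), ψ = normTwoReflectionEquiv (isSymm_hyperbolicSum n) r ε hr hε} φ := by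
  have h01 : (⟨0, by omega⟩ : Fin n) ≠ ⟨1, by omega⟩ := by simp [Fin.ext_iff]
  have h02 : (⟨0, by omega⟩ : Fin n) ≠ ⟨2, by omega⟩ := by simp [Fin.ext_iff]
  have h12 : (⟨1, by omega⟩ : Fin n) ≠ ⟨2, by omega⟩ := by simp [Fin.ext_iff]
  obtain ⟨L, hL, hφ⟩ := (hyperbolicSum_isOrientationPreserving_and_det_eq_one_iff_exists_uGens hn ⟨0, by omega⟩ φ).1 ⟨h₁, h₂⟩
  obtain ⟨hrr, hxr, hyr⟩ := hyperbolicSum_root_values h02 ε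
  obtain ⟨-, hx₁r, hy₁r⟩ := hyperbolicSum_root_values h12 ε
  rw [hφ]
  exact isWordIn_reflections_evalEquiv (twoHyperbolicPairs_hyperbolicSum h01) hε hxr hyr hx₁r hy₁r hrr L hL

/-- **Kneser's form (GHS Thm. 1.1 with Cor. 1.2) for `U^{⊕n}`, `n ≥ 3`: `SO⁺(U^{⊕n}) = ⟨σ_aσ_b : a² = b² = −2⟩`** — an isometry of
`hyperbolicSum n` is a word in products of two `(−2)`-reflections iff it lies in `O⁺` with determinant `1` (`O′(L) = S̃O⁺(L) =
SO⁺(L)` for this unimodular `L`). [cite: GritsenkoHulekSankaran2009, Thm. 1.1, Cor. 1.2 and (16)] -/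
theorem hyperbolicSum_isWordIn_negTwoReflectionPairs_iff {n : ℕ} (hn : 3 ≤ n)
    (φ : (hyperbolicSum n).IsometryEquiv (hyperbolicSum n)) :
    IsWordIn {χ : (hyperbolicSum n).IsometryEquiv (hyperbolicSum n) | ∃ (a b : (Fin n → ℤ) × (Fin n → ℤ))
        (ha : hyperbolicSum n a a = -1 + -1) (hb : hyperbolicSum n b b = -1 + -1),
        χ = (normTwoReflectionEquiv (isSymm_hyperbolicSum n) a (-1) ha (by norm_num)).trans
          (normTwoReflectionEquiv (isSymm_hyperbolicSum n) b (-1) hb (by norm_num))} φ ↔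
      φ.IsOrientationPreserving ∧ LinearMap.det (φ : (Fin n → ℤ) × (Fin n → ℤ) →ₗ[ℤ] (Fin n → ℤ) × (Fin n → ℤ)) = 1 := by
  have hB := isSymm_hyperbolicSum n
  have hnd := (isUnimodular_hyperbolicSum n).nondegenerate
  constructor
  · intro hφ
    refine ⟨hφ.isOrientationPreserving hB hnd fun s hs ↦ ?_, hφ.det_eq_one fun s hs ↦ ?_⟩
    · obtain ⟨a, b, ha, hb, rfl⟩ := hs
      rw [LinearMap.BilinForm.IsometryEquiv.isOrientationPreserving_trans_iff hB hnd,
        isOrientationPreserving_normTwoReflectionEquiv_iff _ hB hnd, isOrientationPreserving_normTwoReflectionEquiv_iff _ hB hnd]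
    · obtain ⟨a, b, ha, hb, rfl⟩ := hs
      rw [IsometryEquiv.det_trans_eq_mul, det_normTwoReflectionEquiv _ hB, det_normTwoReflectionEquiv _ hB]
      norm_num
  · rintro ⟨h₁, h₂⟩
    obtain ⟨hS, hSdet⟩ := reflections_symm_mem_and_det hB (ε := -1) (by norm_num)
    refine ((hyperbolicSum_isWordIn_reflections_of_isOrientationPreserving_of_det_eq_one hn (by norm_num) φ h₁ h₂).pairs_of_det_eq_one
      hS hSdet h₂).mono fun χ hχ ↦ ?_
    obtain ⟨s, ⟨a, ha, rfl⟩, t, ⟨b, hb, rfl⟩, rfl⟩ := hχ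
    exact ⟨a, b, ha, hb, rfl⟩

/-- **"Also true with opposite signs": `SO⁺(U^{⊕n}) = ⟨σ_aσ_b : a² = b² = +2⟩`, `n ≥ 3`** — a product of two `(+2)`-reflections
(each outside `O⁺`, of determinant `−1`) lies in `SO⁺`, and conversely `SO⁺ ⊆ ⟨σ_r : r² = 2⟩` has even words.
[cite: GritsenkoHulekSankaran2009, Thm. 1.1, Cor. 1.2 ("also true with opposite signs") and (16)] -/
theorem hyperbolicSum_isWordIn_posTwoReflectionPairs_iff {n : ℕ} (hn : 3 ≤ n)
    (φ : (hyperbolicSum n).IsometryEquiv (hyperbolicSum n)) :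
    IsWordIn {χ : (hyperbolicSum n).IsometryEquiv (hyperbolicSum n) | ∃ (a b : (Fin n → ℤ) × (Fin n → ℤ))
        (ha : hyperbolicSum n a a = 1 + 1) (hb : hyperbolicSum n b b = 1 + 1),
        χ = (normTwoReflectionEquiv (isSymm_hyperbolicSum n) a 1 ha (by norm_num)).trans
          (normTwoReflectionEquiv (isSymm_hyperbolicSum n) b 1 hb (by norm_num))} φ ↔
      φ.IsOrientationPreserving ∧ LinearMap.det (φ : (Fin n → ℤ) × (Fin n → ℤ) →ₗ[ℤ] (Fin n → ℤ) × (Fin n → ℤ)) = 1 := by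
  have hB := isSymm_hyperbolicSum n
  have hnd := (isUnimodular_hyperbolicSum n).nondegenerate
  constructor
  · intro hφ
    refine ⟨hφ.isOrientationPreserving hB hnd fun s hs ↦ ?_, hφ.det_eq_one fun s hs ↦ ?_⟩
    · obtain ⟨a, b, ha, hb, rfl⟩ := hs
      rw [LinearMap.BilinForm.IsometryEquiv.isOrientationPreserving_trans_iff hB hnd,
        isOrientationPreserving_normTwoReflectionEquiv_iff _ hB hnd, isOrientationPreserving_normTwoReflectionEquiv_iff _ hB hnd]
    · obtain ⟨a, b, ha, hb, rfl⟩ := hs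
      rw [IsometryEquiv.det_trans_eq_mul, det_normTwoReflectionEquiv _ hB, det_normTwoReflectionEquiv _ hB]
      norm_num
  · rintro ⟨h₁, h₂⟩
    obtain ⟨hS, hSdet⟩ := reflections_symm_mem_and_det hB (ε := 1) (by norm_num)
    refine ((hyperbolicSum_isWordIn_reflections_of_isOrientationPreserving_of_det_eq_one hn (by norm_num) φ h₁ h₂).pairs_of_det_eq_one
      hS hSdet h₂).mono fun χ hχ ↦ ?_
    obtain ⟨s, ⟨a, ha, rfl⟩, t, ⟨b, hb, rfl⟩, rfl⟩ := hχ
    exact ⟨a, b, ha, hb, rfl⟩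

/-- **Markman's Corollary 7.1: `SO₊(U^{⊕k}) = SRef₊(U^{⊕k})` for `k ≥ 3`** — an isometry of `hyperbolicSum k` lies in `O⁺` with
determinant `1` iff it is a word in the products of two like-sign `(±2)`-reflections (`σ_aσ_b` with `a² = b² = −2` or with
`a² = b² = +2`). [cite: Markman2023GeneralizedKummers, §7 Cor. 7.1] [cite: GritsenkoHulekSankaran2009, Thm. 1.1 and Cor. 1.2] -/
theorem hyperbolicSum_isWordIn_likeSignReflectionPairs_iff {n : ℕ} (hn : 3 ≤ n)
    (φ : (hyperbolicSum n).IsometryEquiv (hyperbolicSum n)) :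
    IsWordIn {χ : (hyperbolicSum n).IsometryEquiv (hyperbolicSum n) | ∃ (ε : ℤ) (hε : ε * ε = 1)
        (a b : (Fin n → ℤ) × (Fin n → ℤ)) (ha : hyperbolicSum n a a = ε + ε) (hb : hyperbolicSum n b b = ε + ε),
        χ = (normTwoReflectionEquiv (isSymm_hyperbolicSum n) a ε ha hε).trans
          (normTwoReflectionEquiv (isSymm_hyperbolicSum n) b ε hb hε)} φ ↔
      φ.IsOrientationPreserving ∧ LinearMap.det (φ : (Fin n → ℤ) × (Fin n → ℤ) →ₗ[ℤ] (Fin n → ℤ) × (Fin n → ℤ)) = 1 := by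
  have hB := isSymm_hyperbolicSum n
  have hnd := (isUnimodular_hyperbolicSum n).nondegenerate
  constructor
  · intro hφ
    refine ⟨hφ.isOrientationPreserving hB hnd fun s hs ↦ ?_, hφ.det_eq_one fun s hs ↦ ?_⟩
    · obtain ⟨ε, hε, a, b, ha, hb, rfl⟩ := hs
      rw [LinearMap.BilinForm.IsometryEquiv.isOrientationPreserving_trans_iff hB hnd,
        isOrientationPreserving_normTwoReflectionEquiv_iff _ hB hnd, isOrientationPreserving_normTwoReflectionEquiv_iff _ hB hnd]
    · obtain ⟨ε, hε, a, b, ha, hb, rfl⟩ := hs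
      rw [IsometryEquiv.det_trans_eq_mul, det_normTwoReflectionEquiv _ hB, det_normTwoReflectionEquiv _ hB]
      norm_num
  · intro h
    refine ((hyperbolicSum_isWordIn_negTwoReflectionPairs_iff hn φ).2 h).mono fun χ hχ ↦ ?_
    obtain ⟨a, b, ha, hb, rfl⟩ := hχ
    exact ⟨-1, by norm_num, a, b, ha, hb, rfl⟩

/-- **`SO(U^{⊕n}) = SRef(U^{⊕n})`, `n ≥ 3`**: an isometry of `hyperbolicSum n` has determinant `1` iff it is a word in products of
two `(±2)`-reflections (any signs) — Wall's `O(U^{⊕n}) = Ref(U^{⊕n})` (row g49-#15) and "`SRef(Λ) := Ref(Λ) ∩ SO(Λ)` […] is generated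
by elements, which are products of an even number of reflections". [cite: Markman2023GeneralizedKummers, §7 (before Cor. 7.1)] [cite: Wall1962OrthogonalGroups] -/
theorem hyperbolicSum_isWordIn_reflectionPairs_iff_det_eq_one {n : ℕ} (hn : 3 ≤ n)
    (φ : (hyperbolicSum n).IsometryEquiv (hyperbolicSum n)) :
    IsWordIn {χ : (hyperbolicSum n).IsometryEquiv (hyperbolicSum n) | ∃ (a b : (Fin n → ℤ) × (Fin n → ℤ)) (ε₁ ε₂ : ℤ)
        (hε₁ : ε₁ * ε₁ = 1) (hε₂ : ε₂ * ε₂ = 1) (ha : hyperbolicSum n a a = ε₁ + ε₁) (hb : hyperbolicSum n b b = ε₂ + ε₂),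
        χ = (normTwoReflectionEquiv (isSymm_hyperbolicSum n) a ε₁ ha hε₁).trans
          (normTwoReflectionEquiv (isSymm_hyperbolicSum n) b ε₂ hb hε₂)} φ ↔
      LinearMap.det (φ : (Fin n → ℤ) × (Fin n → ℤ) →ₗ[ℤ] (Fin n → ℤ) × (Fin n → ℤ)) = 1 := by
  have hB := isSymm_hyperbolicSum n
  constructor
  · intro hφ
    refine hφ.det_eq_one fun s hs ↦ ?_
    obtain ⟨a, b, ε₁, ε₂, hε₁, hε₂, ha, hb, rfl⟩ := hs
    rw [IsometryEquiv.det_trans_eq_mul, det_normTwoReflectionEquiv _ hB, det_normTwoReflectionEquiv _ hB]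
    norm_num
  · intro h₂
    obtain ⟨hS, hSdet⟩ := reflections_symm_mem_and_det' hB
    refine ((hyperbolicSum_isWordIn_reflections hn φ).pairs_of_det_eq_one hS hSdet h₂).mono fun χ hχ ↦ ?_
    obtain ⟨s, ⟨a, ε₁, hε₁, ha, rfl⟩, t, ⟨b, ε₂, hε₂, hb, rfl⟩, rfl⟩ := hχ
    exact ⟨a, b, ε₁, ε₂, hε₁, hε₂, ha, hb, rfl⟩

end HyperbolicSum

/-! ### §3 Every lattice isometric to `U^{⊕n}` and the genus `II_{n,n}`, `n ≥ 3` -/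

section Model

variable {W W' : Type} [AddCommGroup W] [Module.Finite ℤ W] [Module.Free ℤ W] [AddCommGroup W'] [Module.Finite ℤ W']
  [Module.Free ℤ W'] {B : BilinForm ℤ W} {B' : BilinForm ℤ W'}

omit [Module.Finite ℤ W] [Module.Free ℤ W] [Module.Finite ℤ W'] [Module.Free ℤ W'] in
/-- **Words in products of two `(−2)`-reflections transport along isometries** (`e⁻¹(σ_aσ_b)e = σ_{ea}σ_{eb}`).
[cite: GritsenkoHulekSankaran2009, §3.1 ("γσ_rγ⁻¹ = σ_{γ(r)}")] -/
theorem IsWordIn.negTwoReflectionPairs_conj (hB : B.IsSymm) (hB' : B'.IsSymm) {φ : B.IsometryEquiv B}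
    (hφ : IsWordIn {χ : B.IsometryEquiv B | ∃ (a b : W) (ha : B a a = -1 + -1) (hb : B b b = -1 + -1),
      χ = (normTwoReflectionEquiv hB a (-1) ha (by norm_num)).trans (normTwoReflectionEquiv hB b (-1) hb (by norm_num))} φ)
    (e : B.IsometryEquiv B') :
    IsWordIn {χ' : B'.IsometryEquiv B' | ∃ (a b : W') (ha : B' a a = -1 + -1) (hb : B' b b = -1 + -1),
      χ' = (normTwoReflectionEquiv hB' a (-1) ha (by norm_num)).trans (normTwoReflectionEquiv hB' b (-1) hb (by norm_num))}
      (e.symm.trans (φ.trans e)) := by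
  refine (hφ.conj e).bind fun s hs ↦ ?_
  obtain ⟨ψ, ⟨a, b, ha, hb, rfl⟩, rfl⟩ := hs
  have ha' : B' (e a) (e a) = -1 + -1 := by rw [e.map_app, ha]
  have hb' : B' (e b) (e b) = -1 + -1 := by rw [e.map_app, hb]
  refine IsWordIn.congr (IsWordIn.of_mem (φ := (normTwoReflectionEquiv hB' (e a) (-1) ha' (by norm_num)).trans
    (normTwoReflectionEquiv hB' (e b) (-1) hb' (by norm_num))) ⟨e a, e b, ha', hb', rfl⟩) fun v ↦ ?_
  rw [LinearMap.BilinForm.IsometryEquiv.trans_apply, ← normTwoReflectionEquiv_conj_apply hB hB' e ha (by norm_num) ha',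
    ← normTwoReflectionEquiv_conj_apply hB hB' e hb (by norm_num) hb']
  simp only [LinearMap.BilinForm.IsometryEquiv.trans_apply, LinearMap.BilinForm.IsometryEquiv.symm_apply_apply]

/-- **Kneser's form for every `L ≅ U^{⊕n}`, `n ≥ 3`: `SO⁺(L) = ⟨σ_aσ_b : a² = b² = −2⟩`.**
[cite: GritsenkoHulekSankaran2009, Thm. 1.1, Cor. 1.2 and (16)] -/
theorem isWordIn_negTwoReflectionPairs_iff_of_isometryEquiv_hyperbolicSum {n : ℕ} (hn : 3 ≤ n) (hB' : B'.IsSymm)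
    (hnd' : B'.Nondegenerate) (e : (hyperbolicSum n).IsometryEquiv B') (φ' : B'.IsometryEquiv B') :
    IsWordIn {χ' : B'.IsometryEquiv B' | ∃ (a b : W') (ha : B' a a = -1 + -1) (hb : B' b b = -1 + -1),
        χ' = (normTwoReflectionEquiv hB' a (-1) ha (by norm_num)).trans (normTwoReflectionEquiv hB' b (-1) hb (by norm_num))} φ' ↔
      φ'.IsOrientationPreserving ∧ LinearMap.det (φ' : W' →ₗ[ℤ] W') = 1 := by
  constructor
  · intro hφ
    refine ⟨hφ.isOrientationPreserving hB' hnd' fun s hs ↦ ?_, hφ.det_eq_one fun s hs ↦ ?_⟩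
    · obtain ⟨a, b, ha, hb, rfl⟩ := hs
      rw [LinearMap.BilinForm.IsometryEquiv.isOrientationPreserving_trans_iff hB' hnd',
        isOrientationPreserving_normTwoReflectionEquiv_iff _ hB' hnd', isOrientationPreserving_normTwoReflectionEquiv_iff _ hB' hnd']
    · obtain ⟨a, b, ha, hb, rfl⟩ := hs
      rw [IsometryEquiv.det_trans_eq_mul, det_normTwoReflectionEquiv _ hB', det_normTwoReflectionEquiv _ hB']
      norm_num
  · rintro ⟨h₁, h₂⟩
    have hφ₁ : (e.trans (φ'.trans e.symm)).IsOrientationPreserving :=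
      (LinearMap.BilinForm.IsometryEquiv.isOrientationPreserving_trans_trans_symm_iff e φ').2 h₁
    have hφ₂ : LinearMap.det ((e.trans (φ'.trans e.symm) : (hyperbolicSum n).IsometryEquiv _) :
        (Fin n → ℤ) × (Fin n → ℤ) →ₗ[ℤ] (Fin n → ℤ) × (Fin n → ℤ)) = 1 := by
      rw [IsometryEquiv.det_trans_trans_symm, h₂]
    have hw := (hyperbolicSum_isWordIn_negTwoReflectionPairs_iff hn _).2 ⟨hφ₁, hφ₂⟩
    exact (hw.negTwoReflectionPairs_conj (isSymm_hyperbolicSum n) hB' e).congr fun v ↦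
      IsometryEquiv.symm_trans_trans_trans_symm_trans_apply e φ' v

/-- **Kneser's form for the genus `II_{n,n}`, `n ≥ 3`: `SO⁺ = ⟨σ_aσ_b : a² = b² = −2⟩`** for every even unimodular lattice of
rank `2n` and signature `0`. [cite: GritsenkoHulekSankaran2009, Thm. 1.1 and Cor. 1.2] [cite: Huybrechts2016K3, Ch. 14 Cor. 1.3 (i)] -/
theorem isWordIn_negTwoReflectionPairs_iff_of_isUnimodular_of_isEven (hB : B.IsSymm) (hU : B.IsUnimodular) (he : B.IsEven)
    {n : ℕ} (hn : 3 ≤ n) (hrank : finrank ℤ W = 2 * n) (hsig : B.signature = 0) (φ : B.IsometryEquiv B) :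
    IsWordIn {χ : B.IsometryEquiv B | ∃ (a b : W) (ha : B a a = -1 + -1) (hb : B b b = -1 + -1),
        χ = (normTwoReflectionEquiv hB a (-1) ha (by norm_num)).trans (normTwoReflectionEquiv hB b (-1) hb (by norm_num))} φ ↔
      φ.IsOrientationPreserving ∧ LinearMap.det (φ : W →ₗ[ℤ] W) = 1 := by
  obtain ⟨e⟩ := equivalent_hyperbolicSum_of_signature_eq_zero _ hB hU he (by omega) hrank hsig
  exact isWordIn_negTwoReflectionPairs_iff_of_isometryEquiv_hyperbolicSum hn hB hU.nondegenerate e.symm φ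

end Model

end Literature.Topology.FourManifolds

end
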